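import Literature.Analysis.FunctionSpaces.SpinorWightmanPCTWightman
import Literature.Analysis.OperatorTheory.AntiunitaryFromGenerators
import HarnessLib

/-!
# The PCT operator `Θ` of a spinor Wightman theory (Streater–Wightman Thm. 4-7 / 3-9)

Topic `Literature/Analysis/FunctionSpaces`. For a spinor theory `IsSpinorWightmanQFT W` we construct
the antiunitary PCT operator `Θ` of Streater–Wightman (1964), §4-3 Thm. 4-7 (whose Hilbert-space part
is §3-4 Thm. 3-9): on monomial vectors

`Θ φ_{i₀}(f₀) ⋯ φ_{i_{n−1}}(f_{n−1}) Ω = σ ∑_β conj(∏ⱼ C_{kⱼ}(αⱼ, βⱼ)) φ_{(k₀,β₀)†}(f̃₀) ⋯ φ_{(k_{n−1},β_{n−1})†}(f̃_{n−1}) Ω`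

(`iⱼ = (kⱼ, αⱼ)`, `C_k = SL2C.pctMatrix (S k)`, `f̃(x) = conj f(−x)`, `σ = (−1)^{F(F−1)/2}`): the PCT
identity for covariant families (`SpinorWightmanPCTIdentityFam`), the PCT matrix of the conjugate
representation (`SL2CPCTMatrixConj`), the action of `S(−1)` on the adjoint multiplets and the
vanishing for an odd number of Fermi letters (`SpinorWightmanWrongParity`) show that this assignment
**reverses inner products** (`inner_thetaVec`), and its image has dense span; hence
(`AntiunitaryFromGenerators`) it extends to an antiunitary `Θ` (`exists_theta`) with `Θ Ω = Ω`,
`Θ D₀ ⊆ D₀` and `Θ U(a, A) = U(−a, A) Θ` (`exists_pctOperator`).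

## References

* R. F. Streater, A. S. Wightman, *PCT, Spin and Statistics, and All That* (1964; Princeton 2000),
  §3-4 Thm. 3-9, §4-3 Thm. 4-7 eqs. (4-19), (4-41). [StreaterWightman1964]
-/

noncomputable section

open Filter MeasureTheory Set ComplexConjugate Complex
open _root_.Topology
open scoped InnerProductSpace SchwartzMap MatrixGroups
open Literature.MathematicalPhysics Literature.MathematicalPhysics.QuantumLattice

namespace Literature.Analysis.FunctionSpaces

variable {κ : Type*}

/-! ### Signs -/

/-- `fermiPairSign` is real. [folklore] -/
theorem conj_fermiPairSign (l : List Bool) : conj (fermiPairSign l) = fermiPairSign l := by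
  rw [fermiPairSign_eq_pow, map_pow, map_neg, map_one]

/-- The parity identity behind the phase of `Θ`: for `a + b` even,
`(−1)^{C(a+b,2) + b} = (−1)^{C(a,2)} (−1)^{C(b,2)}`. [folklore] -/
theorem neg_one_pow_choose_add {a b : ℕ} (h : Even (a + b)) :
    (-1 : ℂ) ^ (Nat.choose (a + b) 2 + b) = (-1) ^ Nat.choose a 2 * (-1) ^ Nat.choose b 2 := by
  -- `(−1)^{C(a+b,2)} = (−1)^{C(a,2)} (−1)^{C(b,2)} (−1)^{ab}` by induction on `b`
  have key : ∀ b : ℕ, (-1 : ℂ) ^ Nat.choose (a + b) 2 = (-1) ^ Nat.choose a 2 * (-1) ^ Nat.choose b 2 * (-1) ^ (a * b) := by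
    intro b
    induction b with
    | zero => simp
    | succ q ih =>
      rw [show a + (q + 1) = (a + q) + 1 by ring, choose_two_succ, choose_two_succ, pow_add, ih, pow_add, mul_add, mul_one, pow_add,
        pow_add]
      ring
  rw [pow_add, key]
  obtain ⟨r, hr⟩ := h
  -- `a ≡ b (mod 2)`: `(−1)^{ab} (−1)^b = 1`
  have hab : Even (a * b + b) := by
    rcases Nat.even_or_odd b with hb | hb
    · exact (hb.mul_left a).add hb
    · have ha : Odd a := by
        rcases Nat.even_or_odd a with ha | ha
        · exfalso
          have : Odd (a + b) := ha.add_odd hb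
          rw [hr] at this
          exact (Nat.not_even_iff_odd.2 this) ⟨r, rfl⟩
        · exact ha
      exact (ha.mul hb).add_odd hb
  calc (-1 : ℂ) ^ a.choose 2 * (-1) ^ b.choose 2 * (-1) ^ (a * b) * (-1) ^ b
      = (-1) ^ a.choose 2 * (-1) ^ b.choose 2 * (-1) ^ (a * b + b) := by rw [pow_add]; ring
    _ = (-1) ^ a.choose 2 * (-1) ^ b.choose 2 := by rw [hab.neg_one_pow, mul_one]

namespace SpinorWightmanData

variable (W : SpinorWightmanData κ)

/-! ### Multi-indices of appended sequences of families -/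

/-- Transport of an index along an equality of families. [folklore] -/
theorem CovFamily.idx_cast {Φ Φ' : W.CovFamily} (h : Φ' = Φ) (z : Fin Φ'.m) :
    Φ.idx (Fin.cast (congrArg CovFamily.m h) z) = Φ'.idx z := by subst h; rfl

/-- Transport of PCT-matrix entries along an equality of families. [folklore] -/
theorem CovFamily.pctMatrix_cast {Φ Φ' : W.CovFamily} (h : Φ' = Φ) (z z' : Fin Φ'.m) :
    SL2C.pctMatrix Φ.R Φ.continuous_R (Fin.cast (congrArg CovFamily.m h) z) (Fin.cast (congrArg CovFamily.m h) z') =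
      SL2C.pctMatrix Φ'.R Φ'.continuous_R z z' := by subst h; rfl

variable {p n : ℕ} (A : Fin p → W.CovFamily) (B : Fin n → W.CovFamily)

/-- Gluing multi-indices of two blocks into a multi-index of the appended sequence. [folklore] -/
def appendMIdx (x : W.MIdxF A) (y : W.MIdxF B) : W.MIdxF (Fin.append A B) := fun t =>
  Fin.addCases (motive := fun t => Fin ((Fin.append A B t).m))
    (fun a => Fin.cast (congrArg CovFamily.m (Fin.append_left A B a).symm) (x a))
    (fun b => Fin.cast (congrArg CovFamily.m (Fin.append_right A B b).symm) (y b)) t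

/-- First block of the glued multi-index. [folklore] -/
theorem appendMIdx_castAdd (x : W.MIdxF A) (y : W.MIdxF B) (a : Fin p) :
    W.appendMIdx A B x y (Fin.castAdd n a) = Fin.cast (congrArg CovFamily.m (Fin.append_left A B a).symm) (x a) := by
  simp [appendMIdx]

/-- Second block of the glued multi-index. [folklore] -/
theorem appendMIdx_natAdd (x : W.MIdxF A) (y : W.MIdxF B) (b : Fin n) :
    W.appendMIdx A B x y (Fin.natAdd p b) = Fin.cast (congrArg CovFamily.m (Fin.append_right A B b).symm) (y b) := by
  simp [appendMIdx]

/-- Splitting a multi-index of the appended sequence into its two blocks. [folklore] -/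
def splitMIdx (ε : W.MIdxF (Fin.append A B)) : W.MIdxF A × W.MIdxF B :=
  (fun a => Fin.cast (congrArg CovFamily.m (Fin.append_left A B a)) (ε (Fin.castAdd n a)),
    fun b => Fin.cast (congrArg CovFamily.m (Fin.append_right A B b)) (ε (Fin.natAdd p b)))

/-- The multi-indices of an appended sequence are pairs of multi-indices. [folklore] -/
def appendMIdxEquiv : W.MIdxF A × W.MIdxF B ≃ W.MIdxF (Fin.append A B) where
  toFun xy := W.appendMIdx A B xy.1 xy.2
  invFun := W.splitMIdx A B
  left_inv xy := by
    ext a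
    · simp [splitMIdx, appendMIdx_castAdd]
    · simp [splitMIdx, appendMIdx_natAdd]
  right_inv ε := by
    funext t
    refine Fin.addCases (fun a => ?_) (fun b => ?_) t
    · show W.appendMIdx A B (W.splitMIdx A B ε).1 (W.splitMIdx A B ε).2 (Fin.castAdd n a) = _
      rw [appendMIdx_castAdd]; simp [splitMIdx]
    · show W.appendMIdx A B (W.splitMIdx A B ε).1 (W.splitMIdx A B ε).2 (Fin.natAdd p b) = _
      rw [appendMIdx_natAdd]; simp [splitMIdx]

/-- Unfolding the equivalence. [folklore] -/
@[simp] theorem appendMIdxEquiv_apply (xy : W.MIdxF A × W.MIdxF B) : W.appendMIdxEquiv A B xy = W.appendMIdx A B xy.1 xy.2 := rfl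

/-- The letters of a glued multi-index, first block. [folklore] -/
theorem idx_appendMIdx_castAdd (x : W.MIdxF A) (y : W.MIdxF B) (a : Fin p) :
    (Fin.append A B (Fin.castAdd n a)).idx (W.appendMIdx A B x y (Fin.castAdd n a)) = (A a).idx (x a) := by
  rw [appendMIdx_castAdd]
  exact CovFamily.idx_cast W (Fin.append_left A B a).symm (x a)

/-- The letters of a glued multi-index, second block. [folklore] -/
theorem idx_appendMIdx_natAdd (x : W.MIdxF A) (y : W.MIdxF B) (b : Fin n) :
    (Fin.append A B (Fin.natAdd p b)).idx (W.appendMIdx A B x y (Fin.natAdd p b)) = (B b).idx (y b) := by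
  rw [appendMIdx_natAdd]
  exact CovFamily.idx_cast W (Fin.append_right A B b).symm (y b)

/-- PCT-matrix entries between glued multi-indices, first block. [folklore] -/
theorem pctMatrix_appendMIdx_castAdd (x x' : W.MIdxF A) (y y' : W.MIdxF B) (a : Fin p) :
    SL2C.pctMatrix (Fin.append A B (Fin.castAdd n a)).R (Fin.append A B (Fin.castAdd n a)).continuous_R
        (W.appendMIdx A B x y (Fin.castAdd n a)) (W.appendMIdx A B x' y' (Fin.castAdd n a)) =
      SL2C.pctMatrix (A a).R (A a).continuous_R (x a) (x' a) := by
  rw [appendMIdx_castAdd, appendMIdx_castAdd]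
  exact CovFamily.pctMatrix_cast W (Fin.append_left A B a).symm (x a) (x' a)

/-- PCT-matrix entries between glued multi-indices, second block. [folklore] -/
theorem pctMatrix_appendMIdx_natAdd (x x' : W.MIdxF A) (y y' : W.MIdxF B) (b : Fin n) :
    SL2C.pctMatrix (Fin.append A B (Fin.natAdd p b)).R (Fin.append A B (Fin.natAdd p b)).continuous_R
        (W.appendMIdx A B x y (Fin.natAdd p b)) (W.appendMIdx A B x' y' (Fin.natAdd p b)) =
      SL2C.pctMatrix (B b).R (B b).continuous_R (y b) (y' b) := by
  rw [appendMIdx_natAdd, appendMIdx_natAdd]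
  exact CovFamily.pctMatrix_cast W (Fin.append_right A B b).symm (y b) (y' b)

/-- The letter tuple of a glued multi-index is the appended letter tuple. [folklore] -/
theorem idx_appendMIdx (x : W.MIdxF A) (y : W.MIdxF B) :
    (fun t => (Fin.append A B t).idx (W.appendMIdx A B x y t)) = Fin.append (fun a => (A a).idx (x a)) (fun b => (B b).idx (y b)) := by
  funext t
  refine Fin.addCases (fun a => ?_) (fun b => ?_) t
  · rw [idx_appendMIdx_castAdd, Fin.append_left]
  · rw [idx_appendMIdx_natAdd, Fin.append_right]

/-- The flags of an appended sequence. [folklore] -/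
theorem fermi_append : (fun t => (Fin.append A B t).fermi) = Fin.append (fun a => (A a).fermi) (fun b => (B b).fermi) := by
  funext t
  refine Fin.addCases (fun a => ?_) (fun b => ?_) t
  · rw [Fin.append_left, Fin.append_left]
  · rw [Fin.append_right, Fin.append_right]

/-- Products over an appended sequence of PCT-matrix entries of glued multi-indices. [folklore] -/
theorem prod_pctMatrix_appendMIdx (x x' : W.MIdxF A) (y y' : W.MIdxF B) :
    ∏ t, SL2C.pctMatrix (Fin.append A B t).R (Fin.append A B t).continuous_R (W.appendMIdx A B x y t) (W.appendMIdx A B x' y' t) =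
      (∏ a, SL2C.pctMatrix (A a).R (A a).continuous_R (x a) (x' a)) * ∏ b, SL2C.pctMatrix (B b).R (B b).continuous_R (y b) (y' b) := by
  rw [Fin.prod_univ_add]
  simp only [pctMatrix_appendMIdx_castAdd, pctMatrix_appendMIdx_natAdd]

/-- Reindexing a sum over multi-indices of a reversed sequence. [folklore] -/
theorem sum_revMIdx {m : ℕ} (k : Fin m → κ) (G : W.MIdx (fun j => k (Fin.rev j)) → ℂ) :
    ∑ δ, G δ = ∑ δ'' : W.MIdx k, G (W.revMIdx k δ'') :=
  ((W.revMIdx k).sum_comp G).symm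

/-! ### Monomials with operator-equal letters -/

/-- Monomials only depend on the operators of their letters. [folklore] -/
theorem cMonomial_congr_cfield {m : ℕ} {i i' : Fin m → W.Idx} (h : ∀ j, W.cfield (i j) = W.cfield (i' j)) (f : Fin m → 𝓢(SpaceTime 3, ℂ)) :
    W.cMonomial (List.ofFn fun j => (i j, f j)) = W.cMonomial (List.ofFn fun j => (i' j, f j)) := by
  induction m with
  | zero => simp [List.ofFn_zero]
  | succ q ih =>
    rw [List.ofFn_succ, List.ofFn_succ, cMonomial_cons, cMonomial_cons, ih (fun j => h j.succ)]
    simp only [h 0]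

end SpinorWightmanData

namespace IsSpinorWightmanQFT

open SpinorWightmanData

variable {W : SpinorWightmanData κ}

/-! ### The PCT test function and the `θ`-vectors -/

/-- The PCT-transformed test function `f̃(x) = conj f(−x)`. [cite: StreaterWightman1964, §3-4 Thm 3-9] -/
def thetaTest (f : 𝓢(SpaceTime 3, ℂ)) : 𝓢(SpaceTime 3, ℂ) := starTest (reflectTest f)

/-- `conj f̃ = f̂`. [folklore] -/
theorem starTest_thetaTest (f : 𝓢(SpaceTime 3, ℂ)) : starTest (thetaTest f) = reflectTest f := by
  rw [thetaTest, starTest_starTest]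

/-- `(f̄)^ = f̃`. [folklore] -/
theorem reflectTest_starTest' (f : 𝓢(SpaceTime 3, ℂ)) : reflectTest (starTest f) = thetaTest f := reflectTest_starTest f

/-- `φ_{i††} = φ_i` as operators. [cite: StreaterWightman1964, §3-1] -/
theorem cfield_adj_adj' (hW : IsSpinorWightmanQFT W) (i : W.Idx) : W.cfield (hW.adj (hW.adj i)) = W.cfield i :=
  LinearMap.ext fun f => LinearMap.ext fun ψ => hW.cfield_adj_adj i f ψ

/-- The coefficient `∏ⱼ C_{kⱼ}(αⱼ, βⱼ)` of the `θ`-vector, `iⱼ = (kⱼ, αⱼ)`. [cite: StreaterWightman1964, §4-3 Thm 4-7 eq. (4-41)] -/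
def thetaCoeff (hW : IsSpinorWightmanQFT W) {n : ℕ} (i : Fin n → W.Idx) (β : (j : Fin n) → Fin (W.mult (i j).1)) : ℂ :=
  ∏ j, SL2C.pctMatrix (W.S (i j).1) (hW.continuous_S (i j).1) (i j).2 (β j)

/-- **The `θ`-vector of a tuple of letters**:
`θ(i, f) = σ ∑_β conj(∏ⱼ C_{kⱼ}(αⱼ, βⱼ)) φ_{(k₀,β₀)†}(f̃₀) ⋯ φ_{(k_{n−1},β_{n−1})†}(f̃_{n−1}) Ω`, `σ = (−1)^{F(F−1)/2}`.
[cite: StreaterWightman1964, §4-3 Thm 4-7 eq. (4-41)] -/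
def thetaVecFn (hW : IsSpinorWightmanQFT W) {n : ℕ} (i : Fin n → W.Idx) (f : Fin n → 𝓢(SpaceTime 3, ℂ)) : W.H :=
  fermiPairSign (List.ofFn fun j => W.isFermi (i j).1) •
    ∑ β : (j : Fin n) → Fin (W.mult (i j).1), conj (hW.thetaCoeff i β) •
      (W.cmonomialVec (List.ofFn fun j => (hW.adj ⟨(i j).1, β j⟩, thetaTest (f j))) : W.H)

/-- **The `θ`-vector of a monomial** `φ(l) Ω`. [cite: StreaterWightman1964, §4-3 Thm 4-7 eq. (4-41)] -/
def thetaVec (hW : IsSpinorWightmanQFT W) (l : List W.CLetter) : W.H :=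
  hW.thetaVecFn (fun j : Fin l.length => (l.get j).1) (fun j => (l.get j).2)

/-! ### The two sides of the isometry identity as sums of Wightman functions -/

section Iso

variable (hW : IsSpinorWightmanQFT W) {n p : ℕ}

/-- The common Wightman function `X(β, δ) = ⟪Ω, φ_{k_{n−1}β_{n−1}}(f̂_{n−1}) ⋯ φ_{k₀β₀}(f̂₀) φ_{(κ_{p-1},δ_{p-1})†}(η̃_{p−1}) ⋯ φ_{(κ₀,δ₀)†}(η̃₀) Ω⟫`
of both sides. [folklore] -/
def isoX (i : Fin n → W.Idx) (f : Fin n → 𝓢(SpaceTime 3, ℂ)) (i'' : Fin p → W.Idx) (η : Fin p → 𝓢(SpaceTime 3, ℂ))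
    (β : (j : Fin n) → Fin (W.mult (i j).1)) (δ : (a : Fin p) → Fin (W.mult (i'' a).1)) : ℂ :=
  ⟪W.vacuum, (W.cmonomialVec ((List.ofFn fun j => ((⟨(i (Fin.rev j)).1, β (Fin.rev j)⟩ : W.Idx), reflectTest (f (Fin.rev j)))) ++
    (List.ofFn fun a => (hW.adj ⟨(i'' a).1, δ a⟩, thetaTest (η a))).reverse) : W.H)⟫_ℂ

/-- **Left side**: the inner product of two `θ`-vectors as a double sum of `X`. [folklore] -/
theorem inner_thetaVecFn_eq_sum (i : Fin n → W.Idx) (f : Fin n → 𝓢(SpaceTime 3, ℂ)) (i'' : Fin p → W.Idx) (η : Fin p → 𝓢(SpaceTime 3, ℂ)) :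
    ⟪hW.thetaVecFn i f, hW.thetaVecFn (fun j => i'' (Fin.rev j)) (fun j => η (Fin.rev j))⟫_ℂ =
      fermiPairSign (List.ofFn fun j => W.isFermi (i j).1) * fermiPairSign (List.ofFn fun a => W.isFermi (i'' a).1) *
        ∑ β : (j : Fin n) → Fin (W.mult (i j).1), ∑ δ : (a : Fin p) → Fin (W.mult (i'' a).1),
          hW.thetaCoeff i β * conj (∏ a, SL2C.pctMatrix (W.S (i'' a).1) (hW.continuous_S (i'' a).1) (i'' a).2 (δ a)) *
            hW.isoX i f i'' η β δ := by
  -- the flags of the reversed tuple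
  have hflag : (List.ofFn fun j : Fin p => W.isFermi (i'' (Fin.rev j)).1) = (List.ofFn fun a => W.isFermi (i'' a).1).reverse :=
    (List.reverse_ofFn' (fun a => W.isFermi (i'' a).1)).symm
  have hσ : fermiPairSign (List.ofFn fun j : Fin p => W.isFermi (i'' (Fin.rev j)).1) = fermiPairSign (List.ofFn fun a => W.isFermi (i'' a).1) := by
    rw [hflag, fermiPairSign_eq_pow, fermiPairSign_eq_pow, List.count_reverse]
  rw [thetaVecFn, thetaVecFn, hσ, inner_smul_left, conj_fermiPairSign, inner_smul_right, ← mul_assoc]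
  congr 1
  rw [sum_inner]
  refine Finset.sum_congr rfl fun β _ => ?_
  rw [inner_smul_left, Complex.conj_conj, inner_sum, W.sum_revMIdx (fun a => (i'' a).1), Finset.mul_sum]
  refine Finset.sum_congr rfl fun δ _ => ?_
  rw [inner_smul_right]
  -- the coefficient of the second vector
  have hcoeff : hW.thetaCoeff (fun j => i'' (Fin.rev j)) ((W.revMIdx fun a => (i'' a).1) δ) =
      ∏ a, SL2C.pctMatrix (W.S (i'' a).1) (hW.continuous_S (i'' a).1) (i'' a).2 (δ a) := by
    rw [thetaCoeff]
    exact prod_rev_eq fun a => SL2C.pctMatrix (W.S (i'' a).1) (hW.continuous_S (i'' a).1) (i'' a).2 (δ a)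
  rw [hcoeff]
  -- the inner product of the two monomial vectors is `X`
  have hvec : (W.cmonomialVec (List.ofFn fun j => (hW.adj ⟨(i'' (Fin.rev j)).1, (W.revMIdx (fun a => (i'' a).1) δ) j⟩, thetaTest (η (Fin.rev j)))) : W.H) =
      (W.cmonomialVec (List.ofFn fun a => (hW.adj ⟨(i'' a).1, δ a⟩, thetaTest (η a))).reverse : W.H) := by
    rw [List.reverse_ofFn']
    rfl
  have hinner : ⟪(W.cmonomialVec (List.ofFn fun j => (hW.adj ⟨(i j).1, β j⟩, thetaTest (f j))) : W.H),
      (W.cmonomialVec (List.ofFn fun a => (hW.adj ⟨(i'' a).1, δ a⟩, thetaTest (η a))).reverse : W.H)⟫_ℂ = hW.isoX i f i'' η β δ := by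
    rw [hW.inner_cmonomialVec, hW.starList_ofFn, isoX]
    simp only [starTest_thetaTest]
    -- replace `φ_{i††}` by `φ_i` in the first block
    simp only [cmonomialVec, W.cMonomial_append, LinearMap.comp_apply]
    rw [W.cMonomial_congr_cfield (i := fun j => hW.adj (hW.adj ⟨(i (Fin.rev j)).1, β (Fin.rev j)⟩))
      (i' := fun j => (⟨(i (Fin.rev j)).1, β (Fin.rev j)⟩ : W.Idx)) (fun j => hW.cfield_adj_adj' _)]
  rw [hvec, hinner]
  ring

/-- The appended sequence of families of the right side: adjoint multiplets, then species. [folklore] -/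
abbrev isoSeq (i : Fin n → W.Idx) (i'' : Fin p → W.Idx) : Fin (p + n) → W.CovFamily :=
  Fin.append (fun a => hW.adjFamily (i'' a).1) (fun b => hW.speciesFamily (i b).1)

/-- **Right side**: the inner product `⟪φ(m) Ω, φ(l) Ω⟫` in reversed-`m` parametrisation is the
Wightman function of the appended sequence. [folklore] -/
theorem inner_cmonomialVec_eq_cWightmanFn_isoSeq (i : Fin n → W.Idx) (f : Fin n → 𝓢(SpaceTime 3, ℂ)) (i'' : Fin p → W.Idx)
    (η : Fin p → 𝓢(SpaceTime 3, ℂ)) :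
    ⟪W.vacuum, (W.cmonomialVec ((List.ofFn fun a => (hW.adj (i'' a), starTest (η a))) ++ List.ofFn fun b => (i b, f b)) : W.H)⟫_ℂ =
      W.cWightmanFn (p + n) (fun t => (hW.isoSeq i i'' t).idx
        (W.appendMIdx _ _ (fun a => (i'' a).2) (fun b => (i b).2) t)) (Fin.append (fun a => starTest (η a)) f) := by
  rw [SpinorWightmanData.cWightmanFn]
  congr 3
  rw [← List.ofFn_fin_append]
  congr 1
  funext t
  refine Fin.addCases (fun a => ?_) (fun b => ?_) t
  · simp only [Fin.append_left, isoSeq]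
    rw [W.idx_appendMIdx_castAdd]
    rfl
  · simp only [Fin.append_right, isoSeq]
    rw [W.idx_appendMIdx_natAdd]
    rfl

/-- The reversed–reflected Wightman function of the PCT identity for the appended sequence is `X`. [folklore] -/
theorem cWightmanFn_isoSeq_rev (i : Fin n → W.Idx) (f : Fin n → 𝓢(SpaceTime 3, ℂ)) (i'' : Fin p → W.Idx) (η : Fin p → 𝓢(SpaceTime 3, ℂ))
    (δ : (a : Fin p) → Fin (W.mult (i'' a).1)) (β : (j : Fin n) → Fin (W.mult (i j).1)) :
    W.cWightmanFn (p + n) (fun t => (hW.isoSeq i i'' (Fin.rev t)).idx (W.appendMIdx _ _ δ β (Fin.rev t)))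
        (fun t => reflectTest (Fin.append (fun a => starTest (η a)) f (Fin.rev t))) = hW.isoX i f i'' η β δ := by
  rw [SpinorWightmanData.cWightmanFn, isoX]
  congr 3
  -- the list is the reverse of the appended list
  have h1 : (List.ofFn fun t : Fin (p + n) => ((hW.isoSeq i i'' (Fin.rev t)).idx (W.appendMIdx _ _ δ β (Fin.rev t)),
      reflectTest (Fin.append (fun a => starTest (η a)) f (Fin.rev t)))) =
      (List.ofFn fun t : Fin (p + n) => ((hW.isoSeq i i'' t).idx (W.appendMIdx _ _ δ β t), reflectTest (Fin.append (fun a => starTest (η a)) f t))).reverse :=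
    (List.reverse_ofFn' (fun t : Fin (p + n) => ((hW.isoSeq i i'' t).idx (W.appendMIdx _ _ δ β t),
      reflectTest (Fin.append (fun a => starTest (η a)) f t)))).symm
  have h2 : (fun t : Fin (p + n) => ((hW.isoSeq i i'' t).idx (W.appendMIdx _ _ δ β t), reflectTest (Fin.append (fun a => starTest (η a)) f t))) =
      Fin.append (fun a => (hW.adj ⟨(i'' a).1, δ a⟩, thetaTest (η a))) (fun b => ((⟨(i b).1, β b⟩ : W.Idx), reflectTest (f b))) := by
    funext t
    refine Fin.addCases (fun a => ?_) (fun b => ?_) t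
    · simp only [isoSeq, Fin.append_left]
      rw [W.idx_appendMIdx_castAdd, reflectTest_starTest']
      rfl
    · simp only [isoSeq, Fin.append_right]
      rw [W.idx_appendMIdx_natAdd]
      rfl
  rw [h1, h2, List.ofFn_fin_append, List.reverse_append, List.reverse_ofFn']

/-- The sign product of the letters of `X`: `(−1)^{F_l + F_m}`. [folklore] -/
theorem listStatSign_isoX (i : Fin n → W.Idx) (f : Fin n → 𝓢(SpaceTime 3, ℂ)) (i'' : Fin p → W.Idx) (η : Fin p → 𝓢(SpaceTime 3, ℂ))
    (β : (j : Fin n) → Fin (W.mult (i j).1)) (δ : (a : Fin p) → Fin (W.mult (i'' a).1)) :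
    W.listStatSign ((List.ofFn fun j => ((⟨(i (Fin.rev j)).1, β (Fin.rev j)⟩ : W.Idx), reflectTest (f (Fin.rev j)))) ++
        (List.ofFn fun a => (hW.adj ⟨(i'' a).1, δ a⟩, thetaTest (η a))).reverse) =
      (-1) ^ ((Finset.univ.filter fun j => W.isFermi (i j).1 = true).card + (Finset.univ.filter fun a => W.isFermi (i'' a).1 = true).card) := by
  rw [listStatSign, List.map_append, List.prod_append, List.map_reverse, List.prod_reverse, pow_add]
  have h1 := listStatSign_ofFn (W := W) (fun j => (⟨(i (Fin.rev j)).1, β (Fin.rev j)⟩ : W.Idx)) (fun j => reflectTest (f (Fin.rev j)))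
  have h2 := listStatSign_ofFn (W := W) (fun a => hW.adj ⟨(i'' a).1, δ a⟩) (fun a => thetaTest (η a))
  rw [listStatSign] at h1 h2
  rw [h1, h2]
  congr 1
  · rw [card_filter_rev (fun j => W.isFermi (i j).1)]
  · congr 2
    ext a
    simp only [Finset.mem_filter, Finset.mem_univ, true_and]
    rw [hW.isFermi_adj]

/-- `X` vanishes when the total number of Fermi letters is odd. [folklore] -/
theorem isoX_eq_zero_of_odd (i : Fin n → W.Idx) (f : Fin n → 𝓢(SpaceTime 3, ℂ)) (i'' : Fin p → W.Idx) (η : Fin p → 𝓢(SpaceTime 3, ℂ))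
    (hodd : Odd ((Finset.univ.filter fun j => W.isFermi (i j).1 = true).card + (Finset.univ.filter fun a => W.isFermi (i'' a).1 = true).card))
    (β : (j : Fin n) → Fin (W.mult (i j).1)) (δ : (a : Fin p) → Fin (W.mult (i'' a).1)) : hW.isoX i f i'' η β δ = 0 :=
  hW.inner_vacuum_cmonomialVec_eq_zero _ (by rw [hW.listStatSign_isoX, hodd.neg_one_pow])

/-- `X` with the adjoint block written through the outer monomial: `X(β, δ) = ⟪Ω, φ(L₁) φ(L₂(δ)) Ω⟫`. [folklore] -/
theorem isoX_eq (i : Fin n → W.Idx) (f : Fin n → 𝓢(SpaceTime 3, ℂ)) (i'' : Fin p → W.Idx) (η : Fin p → 𝓢(SpaceTime 3, ℂ))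
    (β : (j : Fin n) → Fin (W.mult (i j).1)) (δ : (a : Fin p) → Fin (W.mult (i'' a).1)) :
    hW.isoX i f i'' η β δ = ⟪W.vacuum, ((W.cMonomial (List.ofFn fun j => ((⟨(i (Fin.rev j)).1, β (Fin.rev j)⟩ : W.Idx), reflectTest (f (Fin.rev j))))
      (W.cMonomial (List.ofFn fun j => (hW.adj ⟨(i'' (Fin.rev j)).1, (W.revMIdx (fun a => (i'' a).1) δ) j⟩, thetaTest (η (Fin.rev j))))
        W.vacuumDom) : W.dom) : W.H)⟫_ℂ := by
  rw [isoX, cmonomialVec, W.cMonomial_append, LinearMap.comp_apply, List.reverse_ofFn']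
  rfl

/-- **The action of `conj S(−1)` on the adjoint block of `X`**: `∑_δ ∏ₐ conj(J(eₐ, δₐ)) X(β, δ) = s_m X(β, e)`. [folklore] -/
theorem sum_conj_J_isoX (i : Fin n → W.Idx) (f : Fin n → 𝓢(SpaceTime 3, ℂ)) (i'' : Fin p → W.Idx) (η : Fin p → 𝓢(SpaceTime 3, ℂ))
    (β : (j : Fin n) → Fin (W.mult (i j).1)) (e : (a : Fin p) → Fin (W.mult (i'' a).1)) :
    ∑ δ : (a : Fin p) → Fin (W.mult (i'' a).1), (∏ a, conj (W.S (i'' a).1 (-1) (e a) (δ a))) * hW.isoX i f i'' η β δ =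
      (∏ a, W.statSign (i'' a).1) * hW.isoX i f i'' η β e := by
  set M := W.cMonomial (List.ofFn fun j => ((⟨(i (Fin.rev j)).1, β (Fin.rev j)⟩ : W.Idx), reflectTest (f (Fin.rev j)))) with hM
  set w : ((a : Fin p) → Fin (W.mult (i'' a).1)) → W.dom := fun δ =>
    W.cMonomial (List.ofFn fun j => (hW.adj ⟨(i'' (Fin.rev j)).1, (W.revMIdx (fun a => (i'' a).1) δ) j⟩, thetaTest (η (Fin.rev j)))) W.vacuumDom
    with hw
  have hX : ∀ δ, hW.isoX i f i'' η β δ = ⟪W.vacuum, ((M (w δ) : W.dom) : W.H)⟫_ℂ := fun δ => hW.isoX_eq i f i'' η β δ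
  simp_rw [hX, ← inner_smul_right, ← inner_sum]
  congr 1
  -- linearity of the outer monomial
  have hlin : ∑ δ, (∏ a, conj (W.S (i'' a).1 (-1) (e a) (δ a))) • ((M (w δ) : W.dom) : W.H) =
      ((M (∑ δ, (∏ a, conj (W.S (i'' a).1 (-1) (e a) (δ a))) • w δ) : W.dom) : W.H) := by
    rw [map_sum]; simp only [map_smul, Submodule.coe_sum, Submodule.coe_smul]
  rw [hlin]
  -- the iterated action of `conj S(−1)` on the adjoint block (reindexed along `rev`)
  have hact := hW.sum_prod_conj_S_neg_one_cMonomial_adj (fun j => (i'' (Fin.rev j)).1) (W.revMIdx (fun a => (i'' a).1) e)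
    (fun j => thetaTest (η (Fin.rev j))) W.vacuumDom
  rw [← (W.revMIdx fun a => (i'' a).1).sum_comp, prod_rev_eq (fun a => W.statSign (i'' a).1)] at hact
  have hprod : ∀ δ : (a : Fin p) → Fin (W.mult (i'' a).1),
      (∏ j, conj (W.S (i'' (Fin.rev j)).1 (-1) ((W.revMIdx (fun a => (i'' a).1) e) j) ((W.revMIdx (fun a => (i'' a).1) δ) j))) =
        ∏ a, conj (W.S (i'' a).1 (-1) (e a) (δ a)) := fun δ =>
    prod_rev_eq fun a => conj (W.S (i'' a).1 (-1) (e a) (δ a))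
  simp only [hprod] at hact
  -- `hact : ∑ δ, c δ • (w δ : H) = (∏ s) • (w e : H)`
  have hvec : (∑ δ, (∏ a, conj (W.S (i'' a).1 (-1) (e a) (δ a))) • w δ : W.dom) = (∏ a, W.statSign (i'' a).1) • w e :=
    Subtype.ext (by simpa only [Submodule.coe_sum, Submodule.coe_smul] using hact)
  rw [hvec, map_smul, Submodule.coe_smul]

/-- **Removing `S(−1)` from the adjoint block**:
`∑_δ conj(∏ₐ (C J)(γₐ, δₐ)) X(β, δ) = s_m ∑_δ conj(∏ₐ C(γₐ, δₐ)) X(β, δ)`. [folklore] -/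
theorem sum_conj_CJ_isoX (i : Fin n → W.Idx) (f : Fin n → 𝓢(SpaceTime 3, ℂ)) (i'' : Fin p → W.Idx) (η : Fin p → 𝓢(SpaceTime 3, ℂ))
    (β : (j : Fin n) → Fin (W.mult (i j).1)) :
    ∑ δ : (a : Fin p) → Fin (W.mult (i'' a).1),
        conj (∏ a, (SL2C.pctMatrix (W.S (i'' a).1) (hW.continuous_S (i'' a).1) * W.S (i'' a).1 (-1)) (i'' a).2 (δ a)) * hW.isoX i f i'' η β δ =
      (∏ a, W.statSign (i'' a).1) * ∑ δ : (a : Fin p) → Fin (W.mult (i'' a).1),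
        conj (∏ a, SL2C.pctMatrix (W.S (i'' a).1) (hW.continuous_S (i'' a).1) (i'' a).2 (δ a)) * hW.isoX i f i'' η β δ := by
  classical
  have hexp : ∀ δ : (a : Fin p) → Fin (W.mult (i'' a).1),
      (∏ a, (SL2C.pctMatrix (W.S (i'' a).1) (hW.continuous_S (i'' a).1) * W.S (i'' a).1 (-1)) (i'' a).2 (δ a)) =
        ∑ e : (a : Fin p) → Fin (W.mult (i'' a).1),
          (∏ a, SL2C.pctMatrix (W.S (i'' a).1) (hW.continuous_S (i'' a).1) (i'' a).2 (e a)) * ∏ a, W.S (i'' a).1 (-1) (e a) (δ a) := by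
    intro δ
    simp only [Matrix.mul_apply]
    rw [Finset.prod_univ_sum]
    simp only [Fintype.piFinset_univ, Finset.prod_mul_distrib]
  simp_rw [hexp, map_sum, map_mul, Finset.sum_mul]
  rw [Finset.sum_comm]
  simp_rw [mul_assoc, ← Finset.mul_sum, map_prod, hW.sum_conj_J_isoX i f i'' η β, ← mul_assoc, mul_comm _ (∏ a, W.statSign (i'' a).1),
    mul_assoc, ← Finset.mul_sum]

/-- **The isometry identity in reversed-`m` parametrisation**:
`⟪θ(i, f), θ(i'' ∘ rev, η ∘ rev)⟫ = ⟪Ω, φ_{(i''₀)†}(η̄₀) ⋯ φ_{(i''_{p−1})†}(η̄_{p−1}) φ_{i₀}(f₀) ⋯ φ_{i_{n−1}}(f_{n−1}) Ω⟫`.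
[cite: StreaterWightman1964, §3-4 Thm 3-9, §4-3 Thm 4-7] -/
theorem inner_thetaVecFn_rev (i : Fin n → W.Idx) (f : Fin n → 𝓢(SpaceTime 3, ℂ)) (i'' : Fin p → W.Idx) (η : Fin p → 𝓢(SpaceTime 3, ℂ)) :
    ⟪hW.thetaVecFn i f, hW.thetaVecFn (fun j => i'' (Fin.rev j)) (fun j => η (Fin.rev j))⟫_ℂ =
      ⟪W.vacuum, (W.cmonomialVec ((List.ofFn fun a => (hW.adj (i'' a), starTest (η a))) ++ List.ofFn fun b => (i b, f b)) : W.H)⟫_ℂ := by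
  classical
  set Fl := (Finset.univ.filter fun j => W.isFermi (i j).1 = true).card with hFl
  set Fm := (Finset.univ.filter fun a => W.isFermi (i'' a).1 = true).card with hFm
  -- the PCT-matrix entries of the two blocks of the appended sequence
  have hadj : ∀ (a : Fin p) (x y : Fin (W.mult (i'' a).1)),
      SL2C.pctMatrix (hW.adjFamily (i'' a).1).R (hW.adjFamily (i'' a).1).continuous_R x y =
        conj ((SL2C.pctMatrix (W.S (i'' a).1) (hW.continuous_S (i'' a).1) * W.S (i'' a).1 (-1)) x y) := fun a x y =>
    SL2C.pctMatrix_of_map_conj_apply (hW.continuous_S _) (hW.adjFamily (i'' a).1).continuous_R (fun _ => rfl) x y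
  have hsp : ∀ (b : Fin n) (x y : Fin (W.mult (i b).1)),
      SL2C.pctMatrix (hW.speciesFamily (i b).1).R (hW.speciesFamily (i b).1).continuous_R x y =
        SL2C.pctMatrix (W.S (i b).1) (hW.continuous_S (i b).1) x y := fun _ _ _ => rfl
  -- the flags of the appended sequence
  have hσ' : fermiPairSign (List.ofFn fun t => (hW.isoSeq i i'' t).fermi) = (-1) ^ Nat.choose (Fm + Fl) 2 := by
    have h : (fun t => (hW.isoSeq i i'' t).fermi) = Fin.append (fun a => W.isFermi (i'' a).1) (fun b => W.isFermi (i b).1) := by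
      rw [isoSeq, W.fermi_append]; rfl
    rw [h, List.ofFn_fin_append, fermiPairSign_eq_pow, List.count_append, count_true_ofFn, count_true_ofFn]
  -- the right side through the PCT identity of the appended sequence, as a double sum over the two blocks
  have hR : ⟪W.vacuum, (W.cmonomialVec ((List.ofFn fun a => (hW.adj (i'' a), starTest (η a))) ++ List.ofFn fun b => (i b, f b)) : W.H)⟫_ℂ =
      (-1) ^ Nat.choose (Fm + Fl) 2 *
        ∑ δ : (a : Fin p) → Fin (W.mult (i'' a).1), ∑ β : (j : Fin n) → Fin (W.mult (i j).1),
          (conj (∏ a, (SL2C.pctMatrix (W.S (i'' a).1) (hW.continuous_S (i'' a).1) * W.S (i'' a).1 (-1)) (i'' a).2 (δ a)) *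
            hW.thetaCoeff i β) * hW.isoX i f i'' η β δ := by
    rw [hW.inner_cmonomialVec_eq_cWightmanFn_isoSeq i f i'' η, hW.cWightmanFn_eq_pct, hσ']
    congr 1
    rw [← (W.appendMIdxEquiv (fun a => hW.adjFamily (i'' a).1) (fun b => hW.speciesFamily (i b).1)).sum_comp, Fintype.sum_prod_type]
    refine Finset.sum_congr rfl fun δ _ => Finset.sum_congr rfl fun β _ => ?_
    rw [appendMIdxEquiv_apply, hW.cWightmanFn_isoSeq_rev i f i'' η δ β]
    simp only [isoSeq]
    rw [W.prod_pctMatrix_appendMIdx]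
    simp only [hadj, hsp, ← map_prod, thetaCoeff]
  -- `J`-removal on the adjoint block and comparison with the left side
  have hJrem : ∑ δ : (a : Fin p) → Fin (W.mult (i'' a).1), ∑ β : (j : Fin n) → Fin (W.mult (i j).1),
      (conj (∏ a, (SL2C.pctMatrix (W.S (i'' a).1) (hW.continuous_S (i'' a).1) * W.S (i'' a).1 (-1)) (i'' a).2 (δ a)) *
        hW.thetaCoeff i β) * hW.isoX i f i'' η β δ =
      (∏ a, W.statSign (i'' a).1) * ∑ β : (j : Fin n) → Fin (W.mult (i j).1), ∑ δ : (a : Fin p) → Fin (W.mult (i'' a).1),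
        hW.thetaCoeff i β * conj (∏ a, SL2C.pctMatrix (W.S (i'' a).1) (hW.continuous_S (i'' a).1) (i'' a).2 (δ a)) *
          hW.isoX i f i'' η β δ := by
    rw [Finset.sum_comm, Finset.mul_sum]
    refine Finset.sum_congr rfl fun β _ => ?_
    have h := hW.sum_conj_CJ_isoX i f i'' η β
    calc ∑ δ : (a : Fin p) → Fin (W.mult (i'' a).1),
          (conj (∏ a, (SL2C.pctMatrix (W.S (i'' a).1) (hW.continuous_S (i'' a).1) * W.S (i'' a).1 (-1)) (i'' a).2 (δ a)) *
            hW.thetaCoeff i β) * hW.isoX i f i'' η β δ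
        = hW.thetaCoeff i β * ∑ δ : (a : Fin p) → Fin (W.mult (i'' a).1),
            conj (∏ a, (SL2C.pctMatrix (W.S (i'' a).1) (hW.continuous_S (i'' a).1) * W.S (i'' a).1 (-1)) (i'' a).2 (δ a)) *
              hW.isoX i f i'' η β δ := by
          rw [Finset.mul_sum]; refine Finset.sum_congr rfl fun δ _ => ?_; ring
      _ = (∏ a, W.statSign (i'' a).1) * ∑ δ : (a : Fin p) → Fin (W.mult (i'' a).1),
            hW.thetaCoeff i β * conj (∏ a, SL2C.pctMatrix (W.S (i'' a).1) (hW.continuous_S (i'' a).1) (i'' a).2 (δ a)) *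
              hW.isoX i f i'' η β δ := by
          rw [h, Finset.mul_sum, Finset.mul_sum, Finset.mul_sum]; refine Finset.sum_congr rfl fun δ _ => ?_; ring
  rw [hR, hJrem, hW.inner_thetaVecFn_eq_sum i f i'' η, fermiPairSign_eq_pow, fermiPairSign_eq_pow, count_true_ofFn, count_true_ofFn,
    prod_statSign]
  -- the phases: by parity of `Fl + Fm`
  rcases Nat.even_or_odd (Fl + Fm) with heven | hodd
  · rw [← mul_assoc]
    congr 1
    have h2 := neg_one_pow_choose_add (a := Fl) (b := Fm) heven
    rw [pow_add] at h2
    rw [Nat.add_comm Fm Fl, h2]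
  · have h0 : ∀ β δ, hW.isoX i f i'' η β δ = 0 := fun β δ => hW.isoX_eq_zero_of_odd i f i'' η hodd β δ
    simp only [h0, mul_zero, Finset.sum_const_zero]

end Iso

/-! ### The isometry identity for monomial vectors -/

/-- **`θ` reverses inner products**: `⟪θ(l), θ(m)⟫ = ⟪φ(m) Ω, φ(l) Ω⟫`. [cite: StreaterWightman1964, §3-4 Thm 3-9, §4-3 Thm 4-7] -/
theorem inner_thetaVec (hW : IsSpinorWightmanQFT W) (l m : List W.CLetter) :
    ⟪hW.thetaVec l, hW.thetaVec m⟫_ℂ = ⟪(W.cmonomialVec m : W.H), (W.cmonomialVec l : W.H)⟫_ℂ := by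
  set i'' : Fin m.length → W.Idx := fun a => (m.get (Fin.rev a)).1 with hi''
  set η : Fin m.length → 𝓢(SpaceTime 3, ℂ) := fun a => (m.get (Fin.rev a)).2 with hη
  have hm1 : (fun j : Fin m.length => (m.get j).1) = fun j => i'' (Fin.rev j) := by
    funext j; simp only [hi'']; rw [Fin.rev_rev]
  have hm2 : (fun j : Fin m.length => (m.get j).2) = fun j => η (Fin.rev j) := by
    funext j; simp only [hη]; rw [Fin.rev_rev]
  have hstar : hW.starList m = List.ofFn fun a => (hW.adj (i'' a), starTest (η a)) := by
    simp only [hi'', hη]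
    rw [starList]
    conv_lhs => rw [← List.ofFn_get m, List.map_ofFn, List.reverse_ofFn']
    rfl
  have hl : (List.ofFn fun b : Fin l.length => ((l.get b).1, (l.get b).2)) = l := List.ofFn_get l
  rw [thetaVec, thetaVec, hm1, hm2, hW.inner_thetaVecFn_rev, hW.inner_cmonomialVec, hstar, hl]

/-! ### Density of the `θ`-vectors -/

/-- `f̃̃ = f`. [folklore] -/
theorem thetaTest_thetaTest (f : 𝓢(SpaceTime 3, ℂ)) : thetaTest (thetaTest f) = f := by
  rw [thetaTest, thetaTest, reflectTest_starTest, starTest_starTest]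
  ext x; simp [reflectTest_apply]

/-- Reindexing `thetaVecFn` along a cast of `Fin`. [folklore] -/
theorem thetaVecFn_cast (hW : IsSpinorWightmanQFT W) {m n : ℕ} (h : m = n) (i : Fin n → W.Idx) (f : Fin n → 𝓢(SpaceTime 3, ℂ)) :
    hW.thetaVecFn (fun j : Fin m => i (Fin.cast h j)) (fun j => f (Fin.cast h j)) = hW.thetaVecFn i f := by
  subst h; rfl

/-- `θ` of an `ofFn` list. [folklore] -/
theorem thetaVec_ofFn (hW : IsSpinorWightmanQFT W) {n : ℕ} (i : Fin n → W.Idx) (f : Fin n → 𝓢(SpaceTime 3, ℂ)) :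
    hW.thetaVec (List.ofFn fun j => (i j, f j)) = hW.thetaVecFn i f := by
  rw [thetaVec]
  have h1 : (fun j : Fin (List.ofFn fun j => (i j, f j)).length => ((List.ofFn fun j => (i j, f j)).get j).1) =
      fun j => i (Fin.cast (List.length_ofFn) j) := by
    funext j; rw [List.get_ofFn]
  have h2 : (fun j : Fin (List.ofFn fun j => (i j, f j)).length => ((List.ofFn fun j => (i j, f j)).get j).2) =
      fun j => f (Fin.cast (List.length_ofFn) j) := by
    funext j; rw [List.get_ofFn]
  rw [h1, h2, hW.thetaVecFn_cast]

/-- **Inverting the `C`-mixing**: `∑_α conj(∏ C(β'_b, α_b)) θ((k,α), f) = σ φ_{(k,β')†}(f̃) ⋯ Ω` (`C² = 1`).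
[cite: StreaterWightman1964, §4-3 Thm 4-7] -/
theorem sum_conj_thetaVecFn (hW : IsSpinorWightmanQFT W) {n : ℕ} (k : Fin n → κ) (β' : W.MIdx k) (f : Fin n → 𝓢(SpaceTime 3, ℂ)) :
    ∑ α : W.MIdx k, conj (∏ b, SL2C.pctMatrix (W.S (k b)) (hW.continuous_S (k b)) (β' b) (α b)) •
        hW.thetaVecFn (fun b => (⟨k b, α b⟩ : W.Idx)) f =
      fermiPairSign (List.ofFn fun b => W.isFermi (k b)) •
        (W.cmonomialVec (List.ofFn fun b => (hW.adj ⟨k b, β' b⟩, thetaTest (f b))) : W.H) := by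
  classical
  -- `∑_α ∏ C(β',α) C(α,β) = ∏ (C²)(β', β) = δ_{β'β}`
  have key : ∀ β : W.MIdx k,
      ∑ α : W.MIdx k, (∏ b, SL2C.pctMatrix (W.S (k b)) (hW.continuous_S (k b)) (β' b) (α b)) *
          (∏ b, SL2C.pctMatrix (W.S (k b)) (hW.continuous_S (k b)) (α b) (β b)) = if β' = β then 1 else 0 := by
    intro β
    have h1 : ∑ α : W.MIdx k, (∏ b, SL2C.pctMatrix (W.S (k b)) (hW.continuous_S (k b)) (β' b) (α b)) *
          (∏ b, SL2C.pctMatrix (W.S (k b)) (hW.continuous_S (k b)) (α b) (β b)) =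
        ∏ b, (SL2C.pctMatrix (W.S (k b)) (hW.continuous_S (k b)) * SL2C.pctMatrix (W.S (k b)) (hW.continuous_S (k b))) (β' b) (β b) := by
      simp only [← Finset.prod_mul_distrib, Matrix.mul_apply]
      rw [Finset.prod_univ_sum]
      simp only [Fintype.piFinset_univ]
    rw [h1]
    simp only [SL2C.pctMatrix_mul_self, Matrix.one_apply]
    rw [Fintype.prod_boole]
    by_cases hb : β' = β
    · subst hb; simp
    · have hb' : ¬∀ b, β' b = β b := fun h => hb (funext h)
      simp [hb, hb']
  simp only [thetaVecFn, thetaCoeff, smul_comm _ (fermiPairSign _), ← Finset.smul_sum]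
  congr 1
  simp only [Finset.smul_sum, smul_smul, ← map_mul]
  calc ∑ α : W.MIdx k, ∑ β : W.MIdx k,
        conj ((∏ b, SL2C.pctMatrix (W.S (k b)) (hW.continuous_S (k b)) (β' b) (α b)) *
          ∏ b, SL2C.pctMatrix (W.S (k b)) (hW.continuous_S (k b)) (α b) (β b)) •
          (W.cmonomialVec (List.ofFn fun b => (hW.adj ⟨k b, β b⟩, thetaTest (f b))) : W.H)
      = ∑ β : W.MIdx k, ∑ α : W.MIdx k,
        conj ((∏ b, SL2C.pctMatrix (W.S (k b)) (hW.continuous_S (k b)) (β' b) (α b)) *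
          ∏ b, SL2C.pctMatrix (W.S (k b)) (hW.continuous_S (k b)) (α b) (β b)) •
          (W.cmonomialVec (List.ofFn fun b => (hW.adj ⟨k b, β b⟩, thetaTest (f b))) : W.H) := Finset.sum_comm
    _ = ∑ β : W.MIdx k, (if β' = β then (1 : ℂ) else 0) • (W.cmonomialVec (List.ofFn fun b => (hW.adj ⟨k b, β b⟩, thetaTest (f b))) : W.H) := by
        refine Finset.sum_congr rfl fun β _ => ?_
        rw [← Finset.sum_smul, ← map_sum, key β]
        split_ifs <;> simp
    _ = (W.cmonomialVec (List.ofFn fun b => (hW.adj ⟨k b, β' b⟩, thetaTest (f b))) : W.H) := by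
        simp only [ite_smul, one_smul, zero_smul, Finset.sum_ite_eq, Finset.mem_univ, if_true]

/-- **The span of the `θ`-vectors is dense.** [cite: StreaterWightman1964, §3-4 Thm 3-9] -/
theorem dense_span_thetaVec (hW : IsSpinorWightmanQFT W) :
    Dense (Submodule.span ℂ (Set.range hW.thetaVec) : Set W.H) := by
  -- every monomial vector of adjoint letters is in the span
  have hadj : ∀ {n : ℕ} (k : Fin n → κ) (β' : W.MIdx k) (g : Fin n → 𝓢(SpaceTime 3, ℂ)),
      (W.cmonomialVec (List.ofFn fun b => (hW.adj ⟨k b, β' b⟩, g b)) : W.H) ∈ Submodule.span ℂ (Set.range hW.thetaVec) := by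
    intro n k β' g
    have h := hW.sum_conj_thetaVecFn k β' (fun b => thetaTest (g b))
    simp only [thetaTest_thetaTest] at h
    have hσ : fermiPairSign (List.ofFn fun b => W.isFermi (k b)) ≠ 0 := by
      rw [fermiPairSign_eq_pow]; exact pow_ne_zero _ (by norm_num)
    have h2 : (W.cmonomialVec (List.ofFn fun b => (hW.adj ⟨k b, β' b⟩, g b)) : W.H) =
        (fermiPairSign (List.ofFn fun b => W.isFermi (k b)))⁻¹ •
          ∑ α : W.MIdx k, conj (∏ b, SL2C.pctMatrix (W.S (k b)) (hW.continuous_S (k b)) (β' b) (α b)) •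
            hW.thetaVecFn (fun b => (⟨k b, α b⟩ : W.Idx)) (fun b => thetaTest (g b)) := by
      rw [h, smul_smul, inv_mul_cancel₀ hσ, one_smul]
    rw [h2]
    refine Submodule.smul_mem _ _ (Submodule.sum_mem _ fun α _ => Submodule.smul_mem _ _ ?_)
    rw [← hW.thetaVec_ofFn]
    exact Submodule.subset_span ⟨_, rfl⟩
  -- hence every monomial vector is (replace each letter `i` by `i††`)
  have hall : ∀ l : List W.CLetter, (W.cmonomialVec l : W.H) ∈ Submodule.span ℂ (Set.range hW.thetaVec) := by
    intro l
    rw [← List.ofFn_get l]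
    have h := hadj (fun b => (hW.adj (l.get b).1).1) (fun b => (hW.adj (l.get b).1).2) (fun b => (l.get b).2)
    have heq : W.cMonomial (List.ofFn fun b => (hW.adj ⟨(hW.adj (l.get b).1).1, (hW.adj (l.get b).1).2⟩, (l.get b).2)) =
        W.cMonomial (List.ofFn fun b => ((l.get b).1, (l.get b).2)) :=
      W.cMonomial_congr_cfield (fun b => hW.cfield_adj_adj' (l.get b).1) _
    simp only [cmonomialVec] at h ⊢
    rw [heq] at h
    exact h
  refine hW.dense_span_cmonomialVec.mono ?_
  exact Submodule.span_le.2 (by rintro _ ⟨l, rfl⟩; exact hall l)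

/-! ### The PCT operator -/

/-- **Existence of the antiunitary `Θ` with `Θ φ(l) Ω = θ(l)`.** [cite: StreaterWightman1964, §3-4 Thm 3-9, §4-3 Thm 4-7] -/
theorem exists_theta (hW : IsSpinorWightmanQFT W) :
    ∃ Θ : W.H ≃ₗᵢ⋆[ℂ] W.H, ∀ l : List W.CLetter, Θ (W.cmonomialVec l : W.H) = hW.thetaVec l :=
  Literature.Analysis.OperatorTheory.exists_antiunitary_extending (fun l => (W.cmonomialVec l : W.H)) hW.thetaVec
    hW.dense_span_cmonomialVec hW.dense_span_thetaVec (fun l m => hW.inner_thetaVec l m)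

/-- `θ([]) = Ω`. [folklore] -/
theorem thetaVec_nil (hW : IsSpinorWightmanQFT W) : hW.thetaVec [] = W.vacuum := by
  have h : hW.thetaVec [] = hW.thetaVecFn (n := 0) Fin.elim0 Fin.elim0 := by
    rw [thetaVec]; congr <;> funext j <;> exact j.elim0
  rw [h]
  simp only [thetaVecFn, thetaCoeff]
  simp [List.ofFn_zero]

/-- `θ(l)` lies in the span of the monomial vectors. [folklore] -/
theorem thetaVec_mem_span (hW : IsSpinorWightmanQFT W) (l : List W.CLetter) :
    hW.thetaVec l ∈ Submodule.span ℂ (Set.range fun l : List W.Letter => (W.fieldMonomial l W.vacuumDom : W.H)) := by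
  rw [← W.range_cmonomialVec_eq, thetaVec, thetaVecFn]
  refine Submodule.smul_mem _ _ (Submodule.sum_mem _ fun β _ => Submodule.smul_mem _ _ (Submodule.subset_span ⟨_, rfl⟩))

/-! ### Covariance of `Θ`: `Θ U(a, A) = U(−a, A) Θ` -/

/-- The PCT test function of a transformed test function: `(f ∘ (a,Λ)⁻¹)̃ = f̃ ∘ (−a, Λ)⁻¹`. [folklore] -/
theorem thetaTest_poincareTest (a : SpaceTime 3) (A : SL(2, ℂ)) (f : 𝓢(SpaceTime 3, ℂ)) :
    thetaTest (poincareTest (SemidirectProduct.inl (Multiplicative.ofAdd a) : PoincareGroup 3) (poincareTest (gSL A) f)) =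
      poincareTest (SemidirectProduct.inl (Multiplicative.ofAdd (-a)) : PoincareGroup 3) (poincareTest (gSL A) (thetaTest f)) := by
  ext x
  simp only [thetaTest, starTest_apply, reflectTest_apply, poincareTest_apply]
  congr 2
  simp [map_neg, sub_eq_add_neg, add_comm]

/-- Commuting the coefficient sums: `∑_β ∏ S(α,β) ∏ C(β,γ) = ∑_β ∏ C(α,β) ∏ S(β,γ)` (`C` is central). [folklore] -/
theorem sum_prod_S_C_comm (hW : IsSpinorWightmanQFT W) {n : ℕ} (k : Fin n → κ) (A : SL(2, ℂ)) (α γ : W.MIdx k) :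
    ∑ β : W.MIdx k, (∏ b, W.S (k b) A (α b) (β b)) * (∏ b, SL2C.pctMatrix (W.S (k b)) (hW.continuous_S (k b)) (β b) (γ b)) =
      ∑ β : W.MIdx k, (∏ b, SL2C.pctMatrix (W.S (k b)) (hW.continuous_S (k b)) (α b) (β b)) * (∏ b, W.S (k b) A (β b) (γ b)) := by
  classical
  have h1 : ∑ β : W.MIdx k, (∏ b, W.S (k b) A (α b) (β b)) * (∏ b, SL2C.pctMatrix (W.S (k b)) (hW.continuous_S (k b)) (β b) (γ b)) =
      ∏ b, (W.S (k b) A * SL2C.pctMatrix (W.S (k b)) (hW.continuous_S (k b))) (α b) (γ b) := by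
    simp only [← Finset.prod_mul_distrib, Matrix.mul_apply]
    rw [Finset.prod_univ_sum]
    simp only [Fintype.piFinset_univ]
  have h2 : ∑ β : W.MIdx k, (∏ b, SL2C.pctMatrix (W.S (k b)) (hW.continuous_S (k b)) (α b) (β b)) * (∏ b, W.S (k b) A (β b) (γ b)) =
      ∏ b, (SL2C.pctMatrix (W.S (k b)) (hW.continuous_S (k b)) * W.S (k b) A) (α b) (γ b) := by
    simp only [← Finset.prod_mul_distrib, Matrix.mul_apply]
    rw [Finset.prod_univ_sum]
    simp only [Fintype.piFinset_univ]
  rw [h1, h2]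
  refine Finset.prod_congr rfl fun b _ => ?_
  rw [(SL2C.commute_pctMatrix (W.S (k b)) (hW.continuous_S (k b)) A).eq]

/-- **`Θ U(a, A) = U(−a, A) Θ` on monomial vectors.** [cite: StreaterWightman1964, §3-4 Thm 3-9, §4-3 Thm 4-7] -/
theorem theta_U_cmonomialVec (hW : IsSpinorWightmanQFT W) {Θ : W.H ≃ₗᵢ⋆[ℂ] W.H}
    (hΘ : ∀ l : List W.CLetter, Θ (W.cmonomialVec l : W.H) = hW.thetaVec l) (a : SpaceTime 3) (A : SL(2, ℂ)) (l : List W.CLetter) :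
    Θ (W.U a A (W.cmonomialVec l : W.H)) = W.U (-a) A (Θ (W.cmonomialVec l : W.H)) := by
  classical
  -- write `l` as a tuple of species letters
  rw [← List.ofFn_get l]
  set n := l.length
  set k : Fin n → κ := fun b => (l.get b).1.1 with hk
  set α : W.MIdx k := fun b => (l.get b).1.2 with hα
  set f : Fin n → 𝓢(SpaceTime 3, ℂ) := fun b => (l.get b).2 with hf
  have hl : (List.ofFn fun b => l.get b) = List.ofFn fun b => ((⟨k b, α b⟩ : W.Idx), f b) := rfl
  rw [hl]
  set σ := fermiPairSign (List.ofFn fun b => W.isFermi (k b)) with hσ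
  -- left side: `U(a, A) φ(l) Ω`
  have hL : W.U a A (W.cmonomialVec (List.ofFn fun b => ((⟨k b, α b⟩ : W.Idx), f b)) : W.H) =
      ∑ β : W.MIdx k, (∏ b, W.S (k b) A⁻¹ (α b) (β b)) •
        (W.cmonomialVec (List.ofFn fun b => ((⟨k b, β b⟩ : W.Idx), (poincareTest (SemidirectProduct.inl (Multiplicative.ofAdd a) : PoincareGroup 3)) (poincareTest (gSL A) (f b)))) : W.H) := by
    show W.transl (Multiplicative.ofAdd a) ((W.spinRep A : W.H →L[ℂ] W.H) _) = _
    rw [hW.spinRep_cmonomialVec A k α f, map_sum]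
    refine Finset.sum_congr rfl fun β _ => ?_
    rw [map_smul, hW.transl_cmonomialVec, List.map_ofFn]
    rfl
  -- `Θ` of the left side
  have hΘL : Θ (W.U a A (W.cmonomialVec (List.ofFn fun b => ((⟨k b, α b⟩ : W.Idx), f b)) : W.H)) =
      ∑ β : W.MIdx k, conj (∏ b, W.S (k b) A⁻¹ (α b) (β b)) • (σ • ∑ γ : W.MIdx k, conj (hW.thetaCoeff (fun b => (⟨k b, β b⟩ : W.Idx)) γ) •
        (W.cmonomialVec (List.ofFn fun b => (hW.adj ⟨k b, γ b⟩, thetaTest ((poincareTest (SemidirectProduct.inl (Multiplicative.ofAdd a) : PoincareGroup 3)) (poincareTest (gSL A) (f b))))) : W.H)) := by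
    rw [hL, map_sum]
    refine Finset.sum_congr rfl fun β _ => ?_
    rw [LinearIsometryEquiv.map_smulₛₗ, hΘ, hW.thetaVec_ofFn]
    rfl
  -- right side: `U(−a, A) θ(l)`
  have hR : W.U (-a) A (Θ (W.cmonomialVec (List.ofFn fun b => ((⟨k b, α b⟩ : W.Idx), f b)) : W.H)) =
      σ • ∑ γ : W.MIdx k, conj (hW.thetaCoeff (fun b => (⟨k b, α b⟩ : W.Idx)) γ) •
        ∑ δ : W.MIdx k, (∏ b, conj (W.S (k b) A⁻¹ (γ b) (δ b))) •
          (W.cmonomialVec (List.ofFn fun b => (hW.adj ⟨k b, δ b⟩, (poincareTest (SemidirectProduct.inl (Multiplicative.ofAdd (-a)) : PoincareGroup 3)) (poincareTest (gSL A) (thetaTest (f b))))) : W.H) := by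
    rw [hΘ, hW.thetaVec_ofFn, thetaVecFn, map_smul, map_sum]
    congr 1
    refine Finset.sum_congr rfl fun γ _ => ?_
    rw [map_smul]
    congr 1
    show W.transl (Multiplicative.ofAdd (-a)) ((W.spinRep A : W.H →L[ℂ] W.H) _) = _
    have h := hW.spinRep_cmonomialVec_fam A (fun b => hW.adjFamily (k b)) γ (fun b => thetaTest (f b))
    simp only [adjFamily_idx, adjFamily_R] at h
    rw [h, map_sum]
    refine Finset.sum_congr rfl fun δ _ => ?_
    rw [map_smul, hW.transl_cmonomialVec, List.map_ofFn]
    rfl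
  -- reorganise both sides as `∑_γ (coefficient) • φ_{(k,γ)†}(…) ⋯ Ω`
  have eL : (∑ β : W.MIdx k, conj (∏ b, W.S (k b) A⁻¹ (α b) (β b)) • (σ • ∑ γ : W.MIdx k, conj (hW.thetaCoeff (fun b => (⟨k b, β b⟩ : W.Idx)) γ) •
        (W.cmonomialVec (List.ofFn fun b => (hW.adj ⟨k b, γ b⟩, thetaTest ((poincareTest (SemidirectProduct.inl (Multiplicative.ofAdd a) : PoincareGroup 3)) (poincareTest (gSL A) (f b))))) : W.H))) =
      ∑ γ : W.MIdx k, (∑ β : W.MIdx k, conj (∏ b, W.S (k b) A⁻¹ (α b) (β b)) * (σ * conj (hW.thetaCoeff (fun b => (⟨k b, β b⟩ : W.Idx)) γ))) •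
        (W.cmonomialVec (List.ofFn fun b => (hW.adj ⟨k b, γ b⟩, thetaTest ((poincareTest (SemidirectProduct.inl (Multiplicative.ofAdd a) : PoincareGroup 3)) (poincareTest (gSL A) (f b))))) : W.H) := by
    simp only [Finset.smul_sum, smul_smul]
    rw [Finset.sum_comm]
    simp only [← Finset.sum_smul]
  have eR : (σ • ∑ γ : W.MIdx k, conj (hW.thetaCoeff (fun b => (⟨k b, α b⟩ : W.Idx)) γ) •
        ∑ δ : W.MIdx k, (∏ b, conj (W.S (k b) A⁻¹ (γ b) (δ b))) •
          (W.cmonomialVec (List.ofFn fun b => (hW.adj ⟨k b, δ b⟩, (poincareTest (SemidirectProduct.inl (Multiplicative.ofAdd (-a)) : PoincareGroup 3)) (poincareTest (gSL A) (thetaTest (f b))))) : W.H)) =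
      ∑ δ : W.MIdx k, (∑ γ : W.MIdx k, σ * (conj (hW.thetaCoeff (fun b => (⟨k b, α b⟩ : W.Idx)) γ) * ∏ b, conj (W.S (k b) A⁻¹ (γ b) (δ b)))) •
        (W.cmonomialVec (List.ofFn fun b => (hW.adj ⟨k b, δ b⟩, (poincareTest (SemidirectProduct.inl (Multiplicative.ofAdd (-a)) : PoincareGroup 3)) (poincareTest (gSL A) (thetaTest (f b))))) : W.H) := by
    simp only [Finset.smul_sum, smul_smul]
    rw [Finset.sum_comm]
    simp only [← Finset.sum_smul]
  rw [hΘL, hR, eL, eR]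
  refine Finset.sum_congr rfl fun γ _ => ?_
  simp only [thetaTest_poincareTest]
  congr 1
  -- the scalar coefficients
  simp only [thetaCoeff, ← map_prod]
  rw [show ∑ x : W.MIdx k, conj (∏ b, W.S (k b) A⁻¹ (α b) (x b)) * (σ * conj (∏ j, SL2C.pctMatrix (W.S (k j)) (hW.continuous_S (k j)) (x j) (γ j))) =
      σ * conj (∑ x : W.MIdx k, (∏ b, W.S (k b) A⁻¹ (α b) (x b)) * ∏ j, SL2C.pctMatrix (W.S (k j)) (hW.continuous_S (k j)) (x j) (γ j)) by
    rw [map_sum, Finset.mul_sum]; refine Finset.sum_congr rfl fun x _ => ?_; rw [map_mul]; ring]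
  rw [hW.sum_prod_S_C_comm k A⁻¹ α γ, map_sum, Finset.mul_sum]
  refine Finset.sum_congr rfl fun δ _ => ?_
  rw [map_mul]

/-- **The PCT operator** (Streater–Wightman (1964), Thm. 4-7 with Thm. 3-9): an antiunitary `Θ` with
`Θ Ω = Ω`, `Θ D₀ ⊆ D₀` and `Θ U(a, A) = U(−a, A) Θ`. [cite: StreaterWightman1964, §4-3 Thm 4-7] -/
theorem exists_pctOperator (hW : IsSpinorWightmanQFT W) :
    ∃ Θ : W.H ≃ₗᵢ⋆[ℂ] W.H,
      Θ W.vacuum = W.vacuum ∧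
      (∀ l : List W.Letter, Θ (W.fieldMonomial l W.vacuumDom : W.H) ∈
        Submodule.span ℂ (Set.range fun l : List W.Letter => (W.fieldMonomial l W.vacuumDom : W.H))) ∧
      (∀ (a : SpaceTime 3) (A : SL(2, ℂ)) (ψ : W.H), Θ (W.U a A ψ) = W.U (-a) A (Θ ψ)) := by
  obtain ⟨Θ, hΘ⟩ := hW.exists_theta
  refine ⟨Θ, ?_, ?_, ?_⟩
  · have h := hΘ []
    rw [cmonomialVec_nil, thetaVec_nil] at h
    exact h
  · intro l
    have h : (W.fieldMonomial l W.vacuumDom : W.H) = (W.cmonomialVec (l.map W.ofLetter) : W.H) := by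
      simp only [cmonomialVec, fieldMonomial_eq_cMonomial]
    rw [h, hΘ]
    exact hW.thetaVec_mem_span _
  · intro a A ψ
    exact Literature.Analysis.OperatorTheory.antiunitary_apply_eq_of_generators Θ (W.U a A) (W.U (-a) A)
      (fun l => (W.cmonomialVec l : W.H)) hW.dense_span_cmonomialVec (fun l => hW.theta_U_cmonomialVec hΘ a A l) ψ

end IsSpinorWightmanQFT

end Literature.Analysis.FunctionSpaces
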